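import Summits.Ventures.LatticeQCDFlow.Scoring.OnePlaquetteBesselRatioMonotone
import HarnessLib

/-!
# The Riccati equations of the Bessel ratios: `(I₁/I₀)' = 1 − (I₁/I₀)/β − (I₁/I₀)²`, `(I₂/I₁)' = 1 − 3(I₂/I₁)/β − (I₂/I₁)²`

HONEST FRAMING: exact (Metropolis-corrected) sampling algorithms for lattice gauge theory;
figures of merit are autocorrelation/cost numbers at stated couplings and volumes; no
continuum-physics claim.

Venture `LatticeQCDFlow` (cell pub-lqcd), sub-topic `Scoring`; FANOUT row 5 (`s0-sun-a`), GEN-16.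
NEW WORK of the cell (placement rule); sequel of `OnePlaquetteBesselRatioMonotone.lean`
(`d⟨cos⟩_β/dβ = ⟨cos²⟩_β − ⟨cos⟩_β²` for the U(1) and SU(2) one-plaquette laws) and of GEN-2's
Schwinger–Dyson identities `⟨cos θ⟩_β = β⟨sin²θ⟩_β`, `3⟨cos α⟩_β = β⟨sin²α⟩_β`
(`SchwingerDysonOnePlaquette.lean`): together they close the variance formula into a first-order ODE
for the plaquette, i.e. for the Bessel ratio (GEN-7's identifications `⟨cos θ⟩_β = I₁(β)/I₀(β)`,
`⟨cos α⟩_β = I₂(β)/I₁(β)`):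

* `onePlaquetteExpect_cos_mul_cos` / `onePlaquetteExpectSU2_cos_mul_cos` — `⟨cos²⟩ = 1 − ⟨sin²⟩`;
* **`hasDerivAt_besselI_one_div_besselI_zero`** — for `β ≠ 0`,
  `(I₁/I₀)'(β) = 1 − (I₁/I₀)(β)/β − (I₁/I₀)(β)²` (so the U(1) one-plaquette variance is
  `v(β) = 1 − t/β − t²`, `t = I₁/I₀`, the form used in GEN-13's `U1TorusPlaquetteVarianceFiniteVolume`);
* **`hasDerivAt_besselI_two_div_besselI_one`** — for `β ≠ 0`,
  `(I₂/I₁)'(β) = 1 − 3(I₂/I₁)(β)/β − (I₂/I₁)(β)²` (the SU(2) one-plaquette variance in closed form).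

These are the `ν = 0, 1` cases of the Riccati equation `r_ν' = 1 − (2ν+1) r_ν/x − r_ν²` of
`r_ν = I_{ν+1}/I_ν` (DLMF 10.29.2 rearranged); not cited as a fact — derived here from the cell's
integration-by-parts identities.  At `β = 0` the slopes are `1/2` and `1/4`
(`OnePlaquetteBesselRatioMonotone` §4).  Nothing is cited as a fact; no `def`.
-/

noncomputable section

open Real MeasureTheory Set intervalIntegral
open Literature.Analysis.FunctionSpaces

namespace Summit.Ventures.LatticeQCDFlow.Scoring

/-! ### 1. `⟨cos²⟩ = 1 − ⟨sin²⟩` and the Riccati equations -/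

/-- U(1): `⟨cos²θ⟩_β = 1 − ⟨sin²θ⟩_β`. -/
theorem onePlaquetteExpect_cos_mul_cos (β : ℝ) :
    onePlaquetteExpect β (fun θ => Real.cos θ * Real.cos θ)
      = 1 - onePlaquetteExpect β (fun θ => Real.sin θ ^ 2) := by
  have hZ := (onePlaquetteZ_pos β).ne'
  unfold onePlaquetteExpect
  have hpt : ∀ θ : ℝ, Real.cos θ * Real.cos θ * Real.exp (β * Real.cos θ)
      = Real.exp (β * Real.cos θ) - Real.sin θ ^ 2 * Real.exp (β * Real.cos θ) := by
    intro θ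
    have h := Real.sin_sq_add_cos_sq θ
    linear_combination Real.exp (β * Real.cos θ) * h
  simp_rw [hpt]
  rw [intervalIntegral.integral_sub (Continuous.intervalIntegrable (by fun_prop) _ _)
    (Continuous.intervalIntegrable (by fun_prop) _ _), ← onePlaquetteZ]
  field_simp

/-- **The Riccati equation of `I₁/I₀`**: for `β ≠ 0`,
`(I₁/I₀)'(β) = 1 − (I₁/I₀)(β)/β − (I₁/I₀)(β)²` (variance formula + `⟨cos θ⟩ = β⟨sin²θ⟩`). -/
theorem hasDerivAt_besselI_one_div_besselI_zero {β : ℝ} (hβ : β ≠ 0) :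
    HasDerivAt (fun x : ℝ => besselI 1 x / besselI 0 x)
      (1 - besselI 1 β / besselI 0 β / β - (besselI 1 β / besselI 0 β) ^ 2) β := by
  have h := hasDerivAt_onePlaquetteExpect_cos β
  have hfun : (fun c => onePlaquetteExpect c Real.cos) = fun x : ℝ => besselI 1 x / besselI 0 x :=
    funext fun c => onePlaquetteExpect_cos_eq_besselI_div c
  rw [hfun] at h
  refine h.congr_deriv ?_
  rw [onePlaquetteExpect_cos_mul_cos, onePlaquetteExpect_cos_eq_besselI_div]
  have hsd := expect_cos_eq_beta_mul_expect_sin_sq β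
  rw [onePlaquetteExpect_cos_eq_besselI_div] at hsd
  have : onePlaquetteExpect β (fun θ => Real.sin θ ^ 2) = besselI 1 β / besselI 0 β / β := by
    rw [eq_div_iff hβ]
    linear_combination -hsd
  rw [this]

/-- SU(2): `⟨cos²α⟩_β = 1 − ⟨sin²α⟩_β` (weight `sin²α e^{β cos α}`). -/
theorem onePlaquetteExpectSU2_cos_mul_cos (β : ℝ) :
    onePlaquetteExpectSU2 β (fun α => Real.cos α * Real.cos α)
      = 1 - onePlaquetteExpectSU2 β (fun α => Real.sin α ^ 2) := by
  have hZ := (onePlaquetteZSU2_pos β).ne'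
  unfold onePlaquetteExpectSU2
  have hpt : ∀ α : ℝ, Real.cos α * Real.cos α * (Real.sin α ^ 2 * Real.exp (β * Real.cos α))
      = Real.sin α ^ 2 * Real.exp (β * Real.cos α)
        - Real.sin α ^ 2 * (Real.sin α ^ 2 * Real.exp (β * Real.cos α)) := by
    intro α
    have h := Real.sin_sq_add_cos_sq α
    linear_combination Real.sin α ^ 2 * Real.exp (β * Real.cos α) * h
  simp_rw [hpt]
  rw [intervalIntegral.integral_sub (Continuous.intervalIntegrable (by fun_prop) _ _)
    (Continuous.intervalIntegrable (by fun_prop) _ _), ← onePlaquetteZSU2]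
  field_simp

/-- **The Riccati equation of `I₂/I₁`**: for `β ≠ 0`,
`(I₂/I₁)'(β) = 1 − 3(I₂/I₁)(β)/β − (I₂/I₁)(β)²` (variance formula + `3⟨cos α⟩ = β⟨sin²α⟩`). -/
theorem hasDerivAt_besselI_two_div_besselI_one {β : ℝ} (hβ : β ≠ 0) :
    HasDerivAt (fun x : ℝ => besselI 2 x / besselI 1 x)
      (1 - 3 * (besselI 2 β / besselI 1 β) / β - (besselI 2 β / besselI 1 β) ^ 2) β := by
  have h := hasDerivAt_onePlaquetteExpectSU2_cos β
  have hfun : (fun c => onePlaquetteExpectSU2 c Real.cos)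
      = fun x : ℝ => besselI 2 x / besselI 1 x :=
    funext fun c => onePlaquetteExpectSU2_cos_eq_besselI_div c
  rw [hfun] at h
  refine h.congr_deriv ?_
  rw [onePlaquetteExpectSU2_cos_mul_cos, onePlaquetteExpectSU2_cos_eq_besselI_div]
  have hsd := three_mul_expect_cos_eq_beta_mul_expect_sin_sq_su2 β
  rw [onePlaquetteExpectSU2_cos_eq_besselI_div] at hsd
  have : onePlaquetteExpectSU2 β (fun α => Real.sin α ^ 2)
      = 3 * (besselI 2 β / besselI 1 β) / β := by
    rw [eq_div_iff hβ]
    linear_combination -hsd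
  rw [this]

end Summit.Ventures.LatticeQCDFlow.Scoring
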